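import Mathlib
import Summits.Ventures.PercRepro2.TypedHarrisCluster
import Summits.Ventures.PercRepro2.TypedSpectator

/-!
# Typed Harris with a spectator for increasing events (blind cell PercRepro2, p3 g8, 2026-08-26;
`proofs/P3-HARRIS.md` §1 — the engine lemma of the (HARRIS-1) / (HARRIS-2) classes)

For two increasing events `P, Q` of configurations and a nonnegative weight `f` on the third copy
(the SPECTATOR), the typed count of the same-copy kernel `f(w)·1_P(x)·1_Q(x)` dominates the typed
count of the cross-copy kernel `f(w)·1_P(x)·1_Q(y)`, on every minor and every type map with values
in `{1, 2}` (`typedCount_harris_spectator`).  Proof: regroup by the third copy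
(`Hub.sum_tset_third`); the typed pairs over `w` form the DAD fibre (`Hub.sum_typed_fibre`), on
which `DAD.fibreHarris` applies to the up-sets `cfg ⁻¹' P`, `cfg ⁻¹' Q`; the spectator weight is a
nonnegative constant on each fibre.  This generalises `TypedHarris.typedCount_cluster_harris`
(two cluster events, no spectator).  The state form `typedCount_slack_nonneg` (a monotone state
map, two monotone Boolean events of states, a nonnegative spectator function of the state) and the
six-fold copy symmetrisation `typedCount_sym6_nonneg` are the forms used by the certificates.
Own work; standard axioms.
-/

namespace Summit.Ventures.PercRepro2

namespace CovForm

namespace TypedHarris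

open Hub

section Fibre

open Classical

variable {E : Type*} [Fintype E] [DecidableEq E] {R : Type*} [Field R] [LinearOrder R]
  [IsStrictOrderedRing R]

omit [Fintype E] in
/-- The preimage of an increasing event of configurations under `cfg` is an up-set of edge sets. -/
lemma isUpperSet_cfg_preimage {P : Set (Config E)} (hP : IsUpperSet P) :
    IsUpperSet {Y : Finset E | cfg Y ∈ P} :=
  fun _ _ hXY hX => hP (cfg_mono hXY) hX

/-- **Harris on one fibre**: over the typed pairs of `w`, the same-copy count of two increasing
events dominates the cross-copy count. -/
theorem fibre_harris_upper (F : Finset E) (z : Config E) (τ : E → ℕ) (w : Config E)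
    (hτ : ∀ e ∈ F, τ e = 1 ∨ τ e = 2) (hw : ∀ e, e ∉ F → w e = z e)
    (P Q : Set (Config E)) (hP : IsUpperSet P) (hQ : IsUpperSet Q) :
    ∑ p ∈ pairSet F z τ w, P.indicator (1 : Config E → R) p.1 * Q.indicator 1 p.2 ≤
      ∑ p ∈ pairSet F z τ w, P.indicator (1 : Config E → R) p.1 * Q.indicator 1 p.1 := by
  rw [sum_typed_fibre F z τ w hτ hw
      (fun x y => P.indicator (1 : Config E → R) x * Q.indicator 1 y),
    sum_typed_fibre F z τ w hτ hw
      (fun x _ => P.indicator (1 : Config E → R) x * Q.indicator 1 x)]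
  have h := DAD.fibreHarris (R := R) (Aset F τ w) (Zset F z τ w) (Zset F z τ w)
    (disjoint_Zset_Aset F z τ w) (disjoint_Zset_Aset F z τ w)
    {Y : Finset E | cfg Y ∈ P} {Y : Finset E | cfg Y ∈ Q}
    (isUpperSet_cfg_preimage hP) (isUpperSet_cfg_preimage hQ)
  simp only [Finset.union_self] at h
  refine le_trans (le_of_eq ?_) (h.trans (le_of_eq ?_))
  · refine Finset.sum_congr rfl fun r _ => ?_
    simp only [xOf, yOf, Set.indicator_apply, Set.mem_setOf_eq, Pi.one_apply]
  · refine Finset.sum_congr rfl fun r _ => ?_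
    simp only [xOf, Set.indicator_apply, Set.mem_setOf_eq, Set.mem_inter_iff, Pi.one_apply]
    by_cases hp : cfg (Zset F z τ w ∪ r) ∈ P <;> by_cases hq : cfg (Zset F z τ w ∪ r) ∈ Q <;>
      simp [hp, hq]

/-- **Typed Harris with a spectator**: for increasing events `P, Q` and a nonnegative spectator
weight `f` on the third copy, the same-copy typed count dominates the cross-copy one, on every
minor and every type map with values in `{1, 2}`. -/
theorem typedCount_harris_spectator (F : Finset E) (z : Config E) (τ : E → ℕ)
    (hτ : ∀ e ∈ F, τ e = 1 ∨ τ e = 2) (f : Config E → R) (hf : ∀ w, 0 ≤ f w)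
    (P Q : Set (Config E)) (hP : IsUpperSet P) (hQ : IsUpperSet Q) :
    typedCount F z τ (fun x y w => f w * (P.indicator (1 : Config E → R) x * Q.indicator 1 y)) ≤
      typedCount F z τ
        (fun x _ w => f w * (P.indicator (1 : Config E → R) x * Q.indicator 1 x)) := by
  rw [typedCount_eq_sum_tset, typedCount_eq_sum_tset, sum_tset_third, sum_tset_third]
  refine Finset.sum_le_sum fun w _ => ?_
  dsimp only
  rw [← Finset.mul_sum, ← Finset.mul_sum]
  by_cases hw : ∀ e, e ∉ F → w e = z e
  · exact mul_le_mul_of_nonneg_left (fibre_harris_upper F z τ w hτ hw P Q hP hQ) (hf w)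
  · rw [pairSet_eq_empty F z τ w hw]
    simp

end Fibre

section States

open Classical

variable {E : Type*} [Fintype E] [DecidableEq E] {R : Type*} [Field R] [LinearOrder R]
  [IsStrictOrderedRing R]

omit [Fintype E] [DecidableEq E] [LinearOrder R] [IsStrictOrderedRing R] in
/-- The indicator of `{x | U (σ x) = true}` is the `0/1` value of `U (σ x)`. -/
lemma indicator_eq_ite {S : Type*} (σ : Config E → S) (U : S → Bool) (x : Config E) :
    ({x : Config E | U (σ x) = true}).indicator (1 : Config E → R) x =
      if U (σ x) = true then 1 else 0 := by
  rw [Set.indicator_apply]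
  simp only [Set.mem_setOf_eq, Pi.one_apply]

omit [LinearOrder R] [IsStrictOrderedRing R] in
/-- The typed count of a difference of kernels. -/
lemma typedCount_sub' (F : Finset E) (z : Config E) (τ : E → ℕ)
    (K K' : Config E → Config E → Config E → R) :
    typedCount F z τ (fun x y w => K x y w - K' x y w) =
      typedCount F z τ K - typedCount F z τ K' := by
  have h := TypedA3.typedCount_add' F z τ K (fun x y w => -K' x y w)
  rw [TypedA3.typedCount_neg'] at h
  simp only [← sub_eq_add_neg] at h
  exact h

/-- **The Harris slack with a spectator, on states**: for a monotone state map `σ`, two monotone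
Boolean events `Ua, Ub` of states and a nonnegative spectator function `g` of the third copy's
state, the typed count of `g(σ w) · 1_{Ua}(σ x) · (1_{Ub}(σ x) − 1_{Ub}(σ y))` is nonnegative. -/
theorem typedCount_slack_nonneg {S : Type*} [Preorder S] (F : Finset E) (z : Config E)
    (τ : E → ℕ) (hτ : ∀ e ∈ F, τ e = 1 ∨ τ e = 2) (σ : Config E → S) (hσ : Monotone σ)
    (Ua Ub : S → Bool) (hUa : ∀ s s', s ≤ s' → Ua s = true → Ua s' = true)
    (hUb : ∀ s s', s ≤ s' → Ub s = true → Ub s' = true) (g : S → R) (hg : ∀ s, 0 ≤ g s) :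
    0 ≤ typedCount F z τ (fun x y w =>
      g (σ w) * ((if Ua (σ x) = true then (1 : R) else 0) *
        ((if Ub (σ x) = true then (1 : R) else 0) - (if Ub (σ y) = true then (1 : R) else 0)))) := by
  have hP : IsUpperSet {x : Config E | Ua (σ x) = true} :=
    fun x x' hx hxP => hUa (σ x) (σ x') (hσ hx) hxP
  have hQ : IsUpperSet {x : Config E | Ub (σ x) = true} :=
    fun x x' hx hxQ => hUb (σ x) (σ x') (hσ hx) hxQ
  have h := typedCount_harris_spectator F z τ hτ (fun w => g (σ w)) (fun w => hg (σ w))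
    {x : Config E | Ua (σ x) = true} {x : Config E | Ub (σ x) = true} hP hQ
  simp only [indicator_eq_ite] at h
  have e : (fun x y w => g (σ w) * ((if Ua (σ x) = true then (1 : R) else 0) *
        ((if Ub (σ x) = true then (1 : R) else 0) - (if Ub (σ y) = true then (1 : R) else 0)))) =
      fun x y w => g (σ w) * ((if Ua (σ x) = true then (1 : R) else 0) *
          (if Ub (σ x) = true then (1 : R) else 0)) -
        g (σ w) * ((if Ua (σ x) = true then (1 : R) else 0) *
          (if Ub (σ y) = true then (1 : R) else 0)) := by
    funext x y w; ring
  rw [e, typedCount_sub']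
  exact sub_nonneg.2 h

omit [LinearOrder R] [IsStrictOrderedRing R] in
/-- **Six-fold copy symmetrisation** (types in `{1, 2}` on `F`): the count of the sum of a kernel
over the six orderings of its arguments is six times its count. -/
theorem typedCount_sym6_eq (F : Finset E) (z : Config E) (τ : E → ℕ)
    (hτ : ∀ e ∈ F, τ e = 1 ∨ τ e = 2) (K : Config E → Config E → Config E → R) :
    typedCount F z τ (fun x y w =>
        K x y w + K x w y + K y x w + K y w x + K w x y + K w y x) =
      6 * typedCount F z τ K := by
  rw [TypedA3.typedCount_add', TypedA3.typedCount_add', TypedA3.typedCount_add',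
    TypedA3.typedCount_add', TypedA3.typedCount_add']
  have t2 := TypedA3.typedCount_swap23 F z τ hτ K
  have t3 := TypedA3.typedCount_swap12 F z τ K
  have t4 := (TypedA3.typedCount_swap12 F z τ (fun x y w => K x w y)).trans t2
  have t5 := (TypedA3.typedCount_swap23 F z τ hτ (fun x y w => K y x w)).trans t3
  have t6 := (TypedA3.typedCount_swap12 F z τ (fun x y w => K w x y)).trans t5
  rw [t2, t3, t4, t5, t6]
  ring

/-- The six-fold copy symmetrisation of a kernel with nonnegative typed count has nonnegative typed
count. -/
theorem typedCount_sym6_nonneg (F : Finset E) (z : Config E) (τ : E → ℕ)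
    (hτ : ∀ e ∈ F, τ e = 1 ∨ τ e = 2) (K : Config E → Config E → Config E → R)
    (hK : 0 ≤ typedCount F z τ K) :
    0 ≤ typedCount F z τ (fun x y w =>
      K x y w + K x w y + K y x w + K y w x + K w x y + K w y x) := by
  rw [typedCount_sym6_eq F z τ hτ K]
  positivity

end States

end TypedHarris

end CovForm

end Summit.Ventures.PercRepro2
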